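import Mathlib
import Literature.Analysis.FluidPDE.Tao2016AveragedNS.ShiftSetCascadeFlows
import Summits.NavierStokesRegularity.NavierStokesRegularity.Theorems.TaoLadderRungTwoFlatMirrorTableDefs
import Summits.NavierStokesRegularity.NavierStokesRegularity.Theorems.TaoLadderRungTwoFlatMirrorField
import Summits.NavierStokesRegularity.NavierStokesRegularity.Theorems.TaoLadderRungTwoFlatQuadPolarOn
import Summits.NavierStokesRegularity.NavierStokesRegularity.Theorems.TaoLadderRungTwoFlatEnergyFluxPointwise
import Summits.NavierStokesRegularity.NavierStokesRegularity.Theorems.TaoLadderRungTwoFlatCoMovingEnergy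
import HarnessLib

/-!
# Tao ladder, rung 2♭ — calculus of the CO-MOVING DEVIATION ENERGY (junk race L8b-1, part 1: derivatives,
  summation by parts, pointwise bounds)
  (helper for item stmt-NavierStokesRegularity-22987 `FlatGapCertificatesV2`, crux K_A♭ of route
  TaoLadderRungTwoFlat; cell harvest/h2-tao-ladder, p1 g21; analytic assembly of theory-1 g37's algebraic core
  `…Theorems.TaoLadderRungTwoFlatCoMovingEnergy`, LADDER §49.2–49.3)

Setting: the graded mirror lattice `Ẋ = quadTermOn S♭ ε₀ (mirrorTable ε ε) X` (clocks `c_n = (1+ε₀)^{5n/2}`,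
species `0 = a = p`, `1 = v = q`), a TEMPLATE solution `W` (in the application: the co-moving pulse `κΦ̃`) and the
DEVIATION `u` of a second solution `X = W + u`; co-moving block energy
`V_s(t) = Σ_{n∈s} e^{θ(n − n_e(t))}·½|u_n(t)|²`, `n_e(t) = n₀ + σt` (`MirrorPulse.coMovingEnergyOn`).

* `hasDerivAt_deviationEnergy` — `d/dt ½|u_n|² = (T_{n−1}(u) − T_n(u)) + C_n`, `T_n(u) = fluxT ε ε₀ u n` the
  deviation's own cubic flux, `C_n = Σᵢ uᵢ,ₙ·Lin_W(u)ᵢ,ₙ` the cross term (from `deviation_site_identity`);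
* `hasDerivAt_coMovingEnergyOn` — `dV_s/dt = −σθ·V_s + Σ_{n∈s} φ_n·((T_{n−1} − T_n) + C_n)`, `φ_n = e^{θ(n − n_e(t))}`;
* `abel_sum_Icc` — `Σ_{n=a}^{P} φ_n(T_{n−1} − T_n) = φ_a T_{a−1} − φ_P T_P + Σ_{a ≤ n < P}(φ_{n+1} − φ_n)T_n`;
  `sum_Icc_add_shift`, `sum_Ico_add_shift` — index shifts on integer blocks;
* `weighted_flux_bond` — one bond of theory-1's `weighted_flux_sum` with LOCAL amplitude hypotheses;
* `cross_term_le` — one shell of the cross term: `C_n ≤ (1+ε)c̄M(3p_n² + 3q_n² + q_{n−1}² + p_{n+1}²)` when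
  `|W| ≤ M` on shells `n−1, n, n+1` and `c_{n−1}, c_n ≤ c̄` (the 10-monomial stencil `cross_term_explicit`, AM–GM).

The block rate bound and its time integration are in `…CoMovingEnergyRate` / `…CoMovingEnergyDecay`.

HONEST FRAMING: calculus identities/inequalities about a MODEL lattice (Tao 2016 §4 vocabulary on `S♭`),
kernel-checked; nothing certified about any orbit; nothing about the Navier–Stokes equations.
-/

noncomputable section

-- the sub-problem namespace repeats the summit name by design (D-0017)
set_option linter.dupNamespace false

namespace Summit.NavierStokesRegularity.NavierStokesRegularity.Theorems

open Set Filter Literature.Analysis.FluidPDE Literature.Analysis.FluidPDE.TaoCascade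
open scoped Topology

namespace MirrorPulse

/-! ### 0. Clocks -/

/-- Clocks are nonnegative for `ε₀ ≥ −1`. [cite: Tao2016AveragedNS, §4 (4.1); route TaoLadderRungTwoFlat] -/
theorem clock_nonneg {ε₀ : ℝ} (hε₀ : -1 ≤ ε₀) (n : ℤ) : 0 ≤ clock ε₀ n := by
  unfold clock; exact Real.rpow_nonneg (by linarith) _

/-- Flat lattice: all clocks equal `1`. [cite: Tao2016AveragedNS, §4 (4.1); route TaoLadderRungTwoFlat, λ₀ = 1 layer] -/
theorem clock_zero (n : ℤ) : clock 0 n = 1 := by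
  unfold clock; simp

/-- Graded lattice (`ε₀ ≥ 0`): clocks increase with the shell index — behind a given shell every clock is at most
the clock there (the race behind the pulse only gets easier down the lattice, LADDER §49.6).
[cite: Tao2016AveragedNS, §4 (4.1); route TaoLadderRungTwoFlat, transfer L6/L8b] -/
theorem clock_mono {ε₀ : ℝ} (hε₀ : 0 ≤ ε₀) {n m : ℤ} (h : n ≤ m) : clock ε₀ n ≤ clock ε₀ m := by
  unfold clock
  apply Real.rpow_le_rpow_of_exponent_le (by linarith)
  have : (n : ℝ) ≤ m := by exact_mod_cast h
  linarith

/-! ### 1. Derivatives: the deviation's site energy and the co-moving block energy -/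

/-- **Deviation site energy.** If `u̇ᵢ,ₙ = Qᵢ,ₙ(W+u) − Qᵢ,ₙ(W)` at time `t` (both `W` and `X = W + u` solve the
graded mirror lattice at site `(·,n)`), then `d/dt ½|u_n|² = (T_{n−1}(u) − T_n(u)) + Σᵢ uᵢ,ₙ·Lin_W(u)ᵢ,ₙ`.
[cite: Tao2016AveragedNS, §4 (4.3), (4.8); route TaoLadderRungTwoFlat, L8b-1 (LADDER §49.2–49.3)] -/
theorem hasDerivAt_deviationEnergy {ε ε₀ : ℝ} {W u : Fin 2 → ℤ → ℝ → ℝ} {n : ℤ} {t : ℝ}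
    (hu : ∀ i, HasDerivAt (u i n) (quadTermOn shiftSetFlat ε₀ (mirrorTable ε ε) (W + u) i n t
        - quadTermOn shiftSetFlat ε₀ (mirrorTable ε ε) W i n t) t) :
    HasDerivAt (fun s => (u 0 n s ^ 2 + u 1 n s ^ 2) / 2)
      ((fluxT ε ε₀ u (n - 1) t - fluxT ε ε₀ u n t)
        + ∑ i : Fin 2, u i n t * QuadPolar.linTermOn shiftSetFlat ε₀ (mirrorTable ε ε) W u i n t) t := by
  have h := (((hu 0).pow 2).add ((hu 1).pow 2)).div_const 2
  rw [← deviation_site_identity]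
  refine h.congr_deriv ?_
  simp only [Fin.sum_univ_two, Fin.isValue, Nat.cast_ofNat, Nat.add_one_sub_one, pow_one]
  ring

/-- **Co-moving block energy.** With the edge moving at `σ` shells per unit time, `n_e(t) = n₀ + σt`, and
`u̇ = Q(W+u) − Q(W)` on the block `s` at time `t`:
`dV_s/dt = −σθ·V_s + Σ_{n∈s} e^{θ(n−n_e(t))}·((T_{n−1}(u) − T_n(u)) + Σᵢ uᵢ,ₙLin_W(u)ᵢ,ₙ)`.
[cite: Tao2016AveragedNS, §4 (4.3), §5–§6; route TaoLadderRungTwoFlat, L8b-1 (LADDER §49.3)] -/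
theorem hasDerivAt_coMovingEnergyOn {ε ε₀ θ σ n₀ : ℝ} (s : Finset ℤ) {W u : Fin 2 → ℤ → ℝ → ℝ} {t : ℝ}
    (hu : ∀ i, ∀ n ∈ s, HasDerivAt (u i n) (quadTermOn shiftSetFlat ε₀ (mirrorTable ε ε) (W + u) i n t
        - quadTermOn shiftSetFlat ε₀ (mirrorTable ε ε) W i n t) t) :
    HasDerivAt (fun t' => coMovingEnergyOn s θ (n₀ + σ * t') u t')
      (-(σ * θ) * coMovingEnergyOn s θ (n₀ + σ * t) u t
        + ∑ n ∈ s, Real.exp (θ * ((n : ℝ) - (n₀ + σ * t))) *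
            ((fluxT ε ε₀ u (n - 1) t - fluxT ε ε₀ u n t)
              + ∑ i : Fin 2, u i n t * QuadPolar.linTermOn shiftSetFlat ε₀ (mirrorTable ε ε) W u i n t)) t := by
  unfold coMovingEnergyOn
  have hterm : ∀ n ∈ s, HasDerivAt
      (fun t' => Real.exp (θ * ((n : ℝ) - (n₀ + σ * t'))) * ((u 0 n t' ^ 2 + u 1 n t' ^ 2) / 2))
      (-(σ * θ) * Real.exp (θ * ((n : ℝ) - (n₀ + σ * t))) * ((u 0 n t ^ 2 + u 1 n t ^ 2) / 2)
        + Real.exp (θ * ((n : ℝ) - (n₀ + σ * t))) *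
          ((fluxT ε ε₀ u (n - 1) t - fluxT ε ε₀ u n t)
            + ∑ i : Fin 2, u i n t * QuadPolar.linTermOn shiftSetFlat ε₀ (mirrorTable ε ε) W u i n t)) t :=
    fun n hn => (hasDerivAt_comovingWeight θ σ n₀ n t).mul (hasDerivAt_deviationEnergy fun i => hu i n hn)
  have hsum := HasDerivAt.fun_sum hterm
  refine hsum.congr_deriv ?_
  rw [Finset.mul_sum, ← Finset.sum_add_distrib]
  refine Finset.sum_congr rfl fun n _ => ?_
  ring

/-- From the two solution hypotheses to the deviation hypothesis: if `W` and `W + u` both solve the lattice at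
`(i,n,t)` then `u̇ᵢ,ₙ(t) = Qᵢ,ₙ(W+u) − Qᵢ,ₙ(W)`. [cite: Tao2016AveragedNS, §4 (4.8); route TaoLadderRungTwoFlat, L8b-1] -/
theorem hasDerivAt_deviation {ε ε₀ : ℝ} {W u : Fin 2 → ℤ → ℝ → ℝ} {i : Fin 2} {n : ℤ} {t : ℝ}
    (hW : HasDerivAt (W i n) (quadTermOn shiftSetFlat ε₀ (mirrorTable ε ε) W i n t) t)
    (hX : HasDerivAt ((W + u) i n) (quadTermOn shiftSetFlat ε₀ (mirrorTable ε ε) (W + u) i n t) t) :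
    HasDerivAt (u i n) (quadTermOn shiftSetFlat ε₀ (mirrorTable ε ε) (W + u) i n t
        - quadTermOn shiftSetFlat ε₀ (mirrorTable ε ε) W i n t) t := by
  have h := hX.sub hW
  have hfun : ((W + u) i n - W i n) = u i n := by
    funext s; simp
  rwa [hfun] at h

/-! ### 2. Summation by parts and index shifts on integer blocks -/

/-- **Abel summation on a block.** For `a ≤ P`:
`Σ_{n=a}^{P} φ_n(T_{n−1} − T_n) = φ_a·T_{a−1} − φ_P·T_P + Σ_{a ≤ n < P}(φ_{n+1} − φ_n)·T_n`. [folklore] -/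
theorem abel_sum_Icc (φ T : ℤ → ℝ) {a P : ℤ} (haP : a ≤ P) :
    ∑ n ∈ Finset.Icc a P, φ n * (T (n - 1) - T n)
      = φ a * T (a - 1) - φ P * T P + ∑ n ∈ Finset.Ico a P, (φ (n + 1) - φ n) * T n := by
  obtain ⟨k, hk⟩ := Int.le.dest haP
  subst hk
  induction k with
  | zero =>
    simp only [Nat.cast_zero, add_zero, Finset.Icc_self, Finset.sum_singleton, Finset.Ico_self,
      Finset.sum_empty]
    ring
  | succ k ih =>
    have hle : a ≤ a + (k : ℕ) := by omega
    have hstep : (a + ((k + 1 : ℕ) : ℤ)) = a + (k : ℕ) + 1 := by push_cast; ring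
    rw [hstep, ← Finset.insert_Icc_right_eq_Icc_add_one (by omega), Finset.sum_insert (by simp),
      ih hle, Finset.Ico_add_one_right_eq_Icc, ← Finset.Ico_insert_right hle,
      Finset.sum_insert Finset.right_notMem_Ico]
    ring_nf

/-- Index shift on a block: `Σ_{n=a}^{b} f(n + c) = Σ_{m=a+c}^{b+c} f(m)`. [folklore] -/
theorem sum_Icc_add_shift {M : Type*} [AddCommMonoid M] (f : ℤ → M) (a b c : ℤ) :
    ∑ n ∈ Finset.Icc a b, f (n + c) = ∑ m ∈ Finset.Icc (a + c) (b + c), f m := by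
  rw [← Finset.map_add_right_Icc, Finset.sum_map]
  rfl

/-- Index shift on a half-open block: `Σ_{a ≤ n < b} f(n + c) = Σ_{a+c ≤ m < b+c} f(m)`. [folklore] -/
theorem sum_Ico_add_shift {M : Type*} [AddCommMonoid M] (f : ℤ → M) (a b c : ℤ) :
    ∑ n ∈ Finset.Ico a b, f (n + c) = ∑ m ∈ Finset.Ico (a + c) (b + c), f m := by
  rw [← Finset.map_add_right_Ico, Finset.sum_map]
  rfl

/-- The co-moving weight one shell up is `e^θ` times the weight: `φ_{n+1} = e^θ·φ_n`.
[cite: Tao2016AveragedNS, §4 (4.3); route TaoLadderRungTwoFlat, L8b-1] -/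
theorem comovingWeight_succ (θ ne : ℝ) (n : ℤ) :
    Real.exp (θ * (((n + 1 : ℤ) : ℝ) - ne)) = Real.exp θ * Real.exp (θ * ((n : ℝ) - ne)) := by
  rw [← Real.exp_add]; congr 1; push_cast; ring

/-- … and one shell down `φ_{n−1} = e^{−θ}·φ_n ≤ φ_n` for `θ ≥ 0`. [cite: Tao2016AveragedNS, §4 (4.3); route TaoLadderRungTwoFlat, L8b-1] -/
theorem comovingWeight_pred (θ ne : ℝ) (n : ℤ) :
    Real.exp (θ * (((n - 1 : ℤ) : ℝ) - ne)) = Real.exp (-θ) * Real.exp (θ * ((n : ℝ) - ne)) := by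
  rw [← Real.exp_add]; congr 1; push_cast; ring

/-- `φ_n = e^θ·φ_{n−1}`. [cite: Tao2016AveragedNS, §4 (4.3); route TaoLadderRungTwoFlat, L8b-1] -/
theorem comovingWeight_eq_exp_mul_pred (θ ne : ℝ) (n : ℤ) :
    Real.exp (θ * ((n : ℝ) - ne)) = Real.exp θ * Real.exp (θ * (((n - 1 : ℤ) : ℝ) - ne)) := by
  rw [← Real.exp_add]; congr 1; push_cast; ring

/-- `φ_n = e^{−θ}·φ_{n+1}`. [cite: Tao2016AveragedNS, §4 (4.3); route TaoLadderRungTwoFlat, L8b-1] -/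
theorem comovingWeight_eq_exp_neg_mul_succ (θ ne : ℝ) (n : ℤ) :
    Real.exp (θ * ((n : ℝ) - ne)) = Real.exp (-θ) * Real.exp (θ * (((n + 1 : ℤ) : ℝ) - ne)) := by
  rw [← Real.exp_add]; congr 1; push_cast; ring

/-! ### 3. Pointwise bounds: one bond of the weighted flux, one shell of the cross term -/

/-- **One bond of the weighted flux** (the summand of `weighted_flux_sum`, with LOCAL amplitude hypotheses):
`(φ_{n+1} − φ_n)·|T_n(X)| ≤ (1+ε)·A·c̄·sinh(θ/2)·(φ_n·v_n² + φ_{n+1}·a_{n+1}²)` whenever `|v_n|, |a_{n+1}| ≤ A` and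
`c_n ≤ c̄`. [cite: Tao2016AveragedNS, §4 (4.3); route TaoLadderRungTwoFlat, L8b-1 (LADDER §49.2 (4))] -/
theorem weighted_flux_bond {ε ε₀ A θ cbar : ℝ} (hε : 0 ≤ ε) (hε₀ : -1 ≤ ε₀) (hθ : 0 ≤ θ)
    (X : Fin 2 → ℤ → ℝ → ℝ) (t ne : ℝ) (n : ℤ) (hv : |X 1 n t| ≤ A) (ha : |X 0 (n + 1) t| ≤ A)
    (hc : clock ε₀ n ≤ cbar) :
    (Real.exp (θ * (((n + 1 : ℤ) : ℝ) - ne)) - Real.exp (θ * ((n : ℝ) - ne))) * |fluxT ε ε₀ X n t|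
      ≤ (1 + ε) * A * cbar * Real.sinh (θ / 2) *
          (Real.exp (θ * ((n : ℝ) - ne)) * X 1 n t ^ 2
            + Real.exp (θ * (((n + 1 : ℤ) : ℝ) - ne)) * X 0 (n + 1) t ^ 2) := by
  set φ₀ := Real.exp (θ * ((n : ℝ) - ne)) with hφ₀
  have hφs : Real.exp (θ * (((n + 1 : ℤ) : ℝ) - ne)) = Real.exp θ * φ₀ := comovingWeight_succ θ ne n
  rw [hφs]
  have hφn : 0 ≤ φ₀ := (Real.exp_pos _).le
  have hA : 0 ≤ A := (abs_nonneg _).trans hv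
  have hcn : 0 ≤ clock ε₀ n := clock_nonneg hε₀ n
  have he1 : 0 ≤ Real.exp θ - 1 := by linarith [Real.one_le_exp hθ]
  have hT := abs_fluxT_le hε hε₀ X n t hv ha
  have hag := weighted_amgm hθ (X 1 n t) (X 0 (n + 1) t)
  have step1 : (Real.exp θ * φ₀ - φ₀) * |fluxT ε ε₀ X n t|
      ≤ φ₀ * (clock ε₀ n * ((1 + ε) * A)) * ((Real.exp θ - 1) * (|X 1 n t| * |X 0 (n + 1) t|)) := by
    have : (Real.exp θ * φ₀ - φ₀) * |fluxT ε ε₀ X n t| = φ₀ * (Real.exp θ - 1) * |fluxT ε ε₀ X n t| := by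
      ring
    rw [this]
    calc φ₀ * (Real.exp θ - 1) * |fluxT ε ε₀ X n t|
        ≤ φ₀ * (Real.exp θ - 1) * (clock ε₀ n * ((1 + ε) * A) * (|X 1 n t| * |X 0 (n + 1) t|)) :=
          mul_le_mul_of_nonneg_left hT (mul_nonneg hφn he1)
      _ = φ₀ * (clock ε₀ n * ((1 + ε) * A)) * ((Real.exp θ - 1) * (|X 1 n t| * |X 0 (n + 1) t|)) := by
          ring
  have step2 : φ₀ * (clock ε₀ n * ((1 + ε) * A)) * ((Real.exp θ - 1) * (|X 1 n t| * |X 0 (n + 1) t|))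
      ≤ φ₀ * (clock ε₀ n * ((1 + ε) * A)) *
          (Real.sinh (θ / 2) * (X 1 n t ^ 2 + Real.exp θ * X 0 (n + 1) t ^ 2)) :=
    mul_le_mul_of_nonneg_left hag (by positivity)
  have step3 : φ₀ * (clock ε₀ n * ((1 + ε) * A)) *
        (Real.sinh (θ / 2) * (X 1 n t ^ 2 + Real.exp θ * X 0 (n + 1) t ^ 2))
      ≤ φ₀ * (cbar * ((1 + ε) * A)) * (Real.sinh (θ / 2) * (X 1 n t ^ 2 + Real.exp θ * X 0 (n + 1) t ^ 2)) := by
    have hsinh : 0 ≤ Real.sinh (θ / 2) := Real.sinh_nonneg_iff.mpr (by linarith)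
    have h2 : 0 ≤ Real.sinh (θ / 2) * (X 1 n t ^ 2 + Real.exp θ * X 0 (n + 1) t ^ 2) := by positivity
    gcongr
  calc (Real.exp θ * φ₀ - φ₀) * |fluxT ε ε₀ X n t|
      ≤ φ₀ * (cbar * ((1 + ε) * A)) * (Real.sinh (θ / 2) * (X 1 n t ^ 2 + Real.exp θ * X 0 (n + 1) t ^ 2)) :=
        step1.trans (step2.trans step3)
    _ = (1 + ε) * A * cbar * Real.sinh (θ / 2) * (φ₀ * X 1 n t ^ 2 + Real.exp θ * φ₀ * X 0 (n + 1) t ^ 2) := by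
        ring

/-- Cubic monomial bound: `|x| ≤ M`, `k ≥ 0` ⇒ `±(k·x·y·z) ≤ k·M·(y² + z²)/2`. [folklore] -/
theorem monomial_three_le {k x y z M : ℝ} (hk : 0 ≤ k) (hx : |x| ≤ M) :
    k * x * y * z ≤ k * M * ((y ^ 2 + z ^ 2) / 2) ∧ -(k * x * y * z) ≤ k * M * ((y ^ 2 + z ^ 2) / 2) := by
  have hyz : |y| * |z| ≤ (y ^ 2 + z ^ 2) / 2 := by
    nlinarith [sq_nonneg (|y| - |z|), sq_abs y, sq_abs z]
  have habs : |k * x * y * z| ≤ k * M * ((y ^ 2 + z ^ 2) / 2) := by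
    rw [abs_mul, abs_mul, abs_mul, abs_of_nonneg hk]
    calc k * |x| * |y| * |z| = k * |x| * (|y| * |z|) := by ring
      _ ≤ k * M * ((y ^ 2 + z ^ 2) / 2) := by
          gcongr
          exact mul_nonneg hk ((abs_nonneg _).trans hx)
  exact ⟨(le_abs_self _).trans habs, (neg_le_abs _).trans habs⟩

/-- Square monomial bound: `|x| ≤ M`, `k ≥ 0` ⇒ `±(k·x·y²) ≤ k·M·y²`. [folklore] -/
theorem monomial_sq_le {k x y M : ℝ} (hk : 0 ≤ k) (hx : |x| ≤ M) :
    k * x * y ^ 2 ≤ k * M * y ^ 2 ∧ -(k * x * y ^ 2) ≤ k * M * y ^ 2 := by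
  have habs : |k * x * y ^ 2| ≤ k * M * y ^ 2 := by
    rw [abs_mul, abs_mul, abs_of_nonneg hk, abs_of_nonneg (sq_nonneg y)]
    gcongr
  exact ⟨(le_abs_self _).trans habs, (neg_le_abs _).trans habs⟩

/-- **One shell of the cross term.** With the template bounded by `M` on shells `n−1, n, n+1` and the two clocks
`c_{n−1}, c_n ≤ c̄`: `Σᵢ uᵢ,ₙ·Lin_W(u)ᵢ,ₙ ≤ (1+ε)·c̄·M·(3p_n² + 3q_n² + q_{n−1}² + p_{n+1}²)` (`p = u 0`, `q = u 1`):
the 10-monomial stencil of `cross_term_explicit`, each monomial split by AM–GM. [cite: Tao2016AveragedNS, §4 (4.8); route TaoLadderRungTwoFlat, L8b-1 (LADDER §49.2 (2))] -/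
theorem cross_term_le {ε ε₀ M cbar : ℝ} (hε : 0 ≤ ε) (hε₀ : -1 ≤ ε₀) (W u : Fin 2 → ℤ → ℝ → ℝ) (n : ℤ)
    (t : ℝ) (hWm : ∀ i, |W i (n - 1) t| ≤ M) (hW0 : ∀ i, |W i n t| ≤ M) (hWp : ∀ i, |W i (n + 1) t| ≤ M)
    (hcm : clock ε₀ (n - 1) ≤ cbar) (hc0 : clock ε₀ n ≤ cbar) :
    ∑ i : Fin 2, u i n t * QuadPolar.linTermOn shiftSetFlat ε₀ (mirrorTable ε ε) W u i n t
      ≤ (1 + ε) * cbar * M *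
          (3 * u 0 n t ^ 2 + 3 * u 1 n t ^ 2 + u 1 (n - 1) t ^ 2 + u 0 (n + 1) t ^ 2) := by
  rw [Fin.sum_univ_two, cross_term_explicit]
  have hM : 0 ≤ M := (abs_nonneg _).trans (hW0 0)
  have hcm0 : 0 ≤ clock ε₀ (n - 1) := clock_nonneg hε₀ _
  have hc00 : 0 ≤ clock ε₀ n := clock_nonneg hε₀ _
  -- names
  set p := u 0 n t
  set q := u 1 n t
  set q' := u 1 (n - 1) t
  set p' := u 0 (n + 1) t
  -- the c_{n-1} group
  have g1 := (monomial_three_le (k := 2) (by norm_num) (hWm 1) (y := p) (z := q')).1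
  have g2 := (monomial_three_le (k := ε) hε (hW0 0) (y := p) (z := q')).1
  have g3 := (monomial_sq_le (k := ε) hε (hWm 1) (y := p)).1
  have hgrp1 : 2 * W 1 (n - 1) t * p * q' + ε * W 0 n t * p * q' + ε * W 1 (n - 1) t * p ^ 2
      ≤ M * ((2 + ε) * ((p ^ 2 + q' ^ 2) / 2) + ε * p ^ 2) := by nlinarith
  have hB1 : 0 ≤ M * ((2 + ε) * ((p ^ 2 + q' ^ 2) / 2) + ε * p ^ 2) := by positivity
  -- the c_n group
  have g4 := (monomial_three_le (k := 1) (by norm_num) (hW0 1) (y := p) (z := q)).2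
  have g5 := (monomial_three_le (k := ε) hε (hW0 0) (y := p) (z := q)).1
  have g6 := (monomial_sq_le (k := ε) hε (hW0 1) (y := p)).2
  have g7 := (monomial_sq_le (k := 1) (by norm_num) (hW0 0) (y := q)).1
  have g8 := (monomial_sq_le (k := 1) (by norm_num) (hWp 0) (y := q)).2
  have g9 := (monomial_three_le (k := 1) (by norm_num) (hW0 1) (y := p') (z := q)).2
  have g10 := (monomial_three_le (k := 2 * ε) (by positivity) (hWp 0) (y := p') (z := q)).2
  have hgrp2 : -(W 1 n t * p * q) + ε * W 0 n t * p * q - ε * W 1 n t * p ^ 2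
        + W 0 n t * q ^ 2 - W 0 (n + 1) t * q ^ 2 - W 1 n t * p' * q
        - 2 * ε * W 0 (n + 1) t * p' * q
      ≤ M * ((1 + ε) * ((p ^ 2 + q ^ 2) / 2) + ε * p ^ 2 + 2 * q ^ 2
          + (1 + 2 * ε) * ((p' ^ 2 + q ^ 2) / 2)) := by nlinarith
  have hB2 : 0 ≤ M * ((1 + ε) * ((p ^ 2 + q ^ 2) / 2) + ε * p ^ 2 + 2 * q ^ 2
      + (1 + 2 * ε) * ((p' ^ 2 + q ^ 2) / 2)) := by positivity
  -- clocks ≤ c̄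
  have e1 : clock ε₀ (n - 1) *
        (2 * W 1 (n - 1) t * p * q' + ε * W 0 n t * p * q' + ε * W 1 (n - 1) t * p ^ 2)
      ≤ cbar * (M * ((2 + ε) * ((p ^ 2 + q' ^ 2) / 2) + ε * p ^ 2)) :=
    (mul_le_mul_of_nonneg_left hgrp1 hcm0).trans (mul_le_mul_of_nonneg_right hcm hB1)
  have e2 : clock ε₀ n *
        (-(W 1 n t * p * q) + ε * W 0 n t * p * q - ε * W 1 n t * p ^ 2
          + W 0 n t * q ^ 2 - W 0 (n + 1) t * q ^ 2 - W 1 n t * p' * q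
          - 2 * ε * W 0 (n + 1) t * p' * q)
      ≤ cbar * (M * ((1 + ε) * ((p ^ 2 + q ^ 2) / 2) + ε * p ^ 2 + 2 * q ^ 2
          + (1 + 2 * ε) * ((p' ^ 2 + q ^ 2) / 2))) :=
    (mul_le_mul_of_nonneg_left hgrp2 hc00).trans (mul_le_mul_of_nonneg_right hc0 hB2)
  have hcbar : 0 ≤ cbar := hc00.trans hc0
  -- the crude final comparison of coefficients (ε ≥ 0)
  have hfin : cbar * (M * ((2 + ε) * ((p ^ 2 + q' ^ 2) / 2) + ε * p ^ 2))
        + cbar * (M * ((1 + ε) * ((p ^ 2 + q ^ 2) / 2) + ε * p ^ 2 + 2 * q ^ 2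
          + (1 + 2 * ε) * ((p' ^ 2 + q ^ 2) / 2)))
      ≤ (1 + ε) * cbar * M * (3 * p ^ 2 + 3 * q ^ 2 + q' ^ 2 + p' ^ 2) := by
    have hcm : 0 ≤ cbar * M := mul_nonneg hcbar hM
    nlinarith [mul_nonneg hcm (sq_nonneg p), mul_nonneg hcm (sq_nonneg q), mul_nonneg hcm (sq_nonneg q'),
      mul_nonneg hcm (sq_nonneg p'), mul_nonneg (mul_nonneg hcm hε) (sq_nonneg p),
      mul_nonneg (mul_nonneg hcm hε) (sq_nonneg q), mul_nonneg (mul_nonneg hcm hε) (sq_nonneg q'),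
      mul_nonneg (mul_nonneg hcm hε) (sq_nonneg p')]
  linarith [e1, e2, hfin]

end MirrorPulse

end Summit.NavierStokesRegularity.NavierStokesRegularity.Theorems

end
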